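import Mathlib
import Literature.AlgebraicGeometry.Resolution.FormalShear
import Literature.AlgebraicGeometry.Resolution.PlaneGermBlowupCalculus

/-!
# `WeightedInvariant.LocalWeightedDrop`, line `hasse-ridge-face-selection`: the bad-chain assembly

Crux item stmt-ResolutionOfSingularities-8899 (route `ResolutionOfSingularities/WeightedInvariant`),
skeleton v14 of the line `hasse-ridge-face-selection`, stub `stub_badChainAssembly` (GLUE), PROVED here
(statement verbatim from the ledger registration).

**Statement.**  Over a field `k` (`x = X 0`, `y = X 1` in `k[[x, y]]`), assume the folklore packages
(A) STRICT TRANSFORMS AND ORDER ((A1) the strict transform does not gain order; (A2) if it keeps the order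
`m` it contains `y^m`; (A3) a germ of order `m` containing `y^m` has a unit strict transform at the vertical
point), (C) EXCEPTIONAL AND SMOOTH CALCULUS (transforms of `v · x^a · y^c`, `v` a unit, in the three kinds
of charts; orders of `v · x^a · y^c · L^n` for `L(0) = 0`, `∂L/∂y(0) ≠ 0`; the model normal crossings
`v · x^a · y^c`, `v · x · L^n`; transforms of such `L`), and (P) PERSISTENT ORDER `m ≥ 1` along slope
charts forces `h₀ = u · L^m`.  Then for every `f : ℕ → k[[x, y]]` some step `f i → f (i+1)` is not a bad
step (`PlaneGerm.IsBadStep`): there is no infinite chain of non-normal-crossing infinitely near points.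

**Proof (chain assembly).**  Suppose every step is bad; choose the charts `Φ i` and let `g 0 = f 0`,
`g (i+1)` = the strict transform of `g i` in `Φ i` (non-zero: `PlaneGerm.exists_isTransform`,
`PlaneGerm.isTransform_ne_zero`).  By induction `f i = v_i · x^{a_i} · y^{c_i} · g i` with `v_i` a unit,
`a_i, c_i ≤ 1`, `a_i = 1` for `i ≥ 1` ((C1)–(C4), multiplicativity of `subst`, `MvPowerSeries.order_mul`,
cancellation of `x^{ord f i}`).  `ord g i` is non-increasing (A1), so constant `= m` from some `i₀` on.
`m = 0`: `f i₀` is a unit times a monomial, a normal crossing (C5).  `m ≥ 1`: `coeff y^m (g (i+1)) ≠ 0`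
for `i ≥ i₀` (A2), so no chart `Φ i`, `i > i₀`, is vertical (A3), and (P) on `j ↦ g (i₀ + 1 + j)` gives
`f (i₀+1) = w · x · y^c · L^m`.  ENDGAME by induction on the least `n₀` with `coeff x^{n₀} L ≠ 0` (if none,
`y ∣ L` and `f (i₀+1)` is a unit times a monomial): `c = 0` is the normal crossing `w · x · L^n` (C5); for
`c = 1` the next germ is `x · unit · y` · unit (vertical, (C3), (C7)), `x · unit · L'^n` (slope `t ≠ 0`,
(C1), (C6)) or `unit · x · y · L'^n` with `n₀(L') = n₀(L) - 1` (slope `0`, (C2), (C6)) — contradiction.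
-/

set_option linter.dupNamespace false -- mandated namespace of this single-conjunct summit

namespace Summit.ResolutionOfSingularities.ResolutionOfSingularities.Theorems

open Literature.AlgebraicGeometry.Resolution

namespace BadChainAssembly

open MvPowerSeries

variable {k : Type} [Field k]

/-- A chart of the first neighbourhood is substitutable, its components are multiples of `x`, and it
kills no non-zero germ. -/
theorem chart_props {Φ : Fin 2 → MvPowerSeries (Fin 2) k}
    (hΦ : (∃ t : k, Φ = PlaneGerm.dirChart t) ∨ Φ = PlaneGerm.vertChart k) :
    HasSubst Φ ∧ (∀ j, (X 0 : MvPowerSeries (Fin 2) k) ∣ Φ j) ∧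
      ∀ b : MvPowerSeries (Fin 2) k, b ≠ 0 → subst Φ b ≠ 0 := by
  rcases hΦ with ⟨t, rfl⟩ | rfl
  · exact ⟨PlaneGerm.hasSubst_dirChart t, PlaneGerm.X_dvd_dirChart t,
      fun b hb => PlaneGerm.subst_dirChart_ne_zero t hb⟩
  · exact ⟨PlaneGerm.hasSubst_vertChart, PlaneGerm.X_dvd_vertChart,
      fun b hb => PlaneGerm.subst_vertChart_ne_zero hb⟩

/-- CANCELLATION: if `D` is the transform germ of `b` in the chart `Φ` and `b∘Φ = x^{ord b} · Q`, then
`D = x · Q`. -/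
theorem eq_X_mul_of_isTransform {Φ : Fin 2 → MvPowerSeries (Fin 2) k}
    {b D Q : MvPowerSeries (Fin 2) k} {M : ℕ} (h : PlaneGerm.IsTransform Φ b D) (hM : b.order = M)
    (hQ : subst Φ b = X 0 ^ M * Q) : D = X 0 * Q := by
  obtain ⟨m, st, hm, hsub, rfl⟩ := h
  obtain rfl : m = M := by rw [hm] at hM; exact_mod_cast hM
  rw [hsub] at hQ
  rw [mul_left_cancel₀ (pow_ne_zero m (FormalCoordChange.X_ne_zero' (0 : Fin 2))) hQ]

/-- THE STRICT-TRANSFORM SEQUENCE along a sequence of charts: `g 0 = b`, and `g (i+1)` is the strict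
transform of `g i` in the chart `Φ i` (`(g i)∘(Φ i) = x^{ord g i} · g (i+1)`); no `g i` vanishes. -/
theorem exists_strictSeq {Φ : ℕ → Fin 2 → MvPowerSeries (Fin 2) k}
    (hΦ : ∀ i, (∃ t : k, Φ i = PlaneGerm.dirChart t) ∨ Φ i = PlaneGerm.vertChart k)
    {b : MvPowerSeries (Fin 2) k} (hb : b ≠ 0) :
    ∃ g : ℕ → MvPowerSeries (Fin 2) k, g 0 = b ∧ ∀ i, g i ≠ 0 ∧
      ∃ m : ℕ, (g i).order = m ∧ subst (Φ i) (g i) = X 0 ^ m * g (i + 1) := by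
  have hex : ∀ (i : ℕ) (c : MvPowerSeries (Fin 2) k), ∃ st : MvPowerSeries (Fin 2) k,
      c ≠ 0 → PlaneGerm.IsTransform (Φ i) c (X 0 * st) := by
    intro i c
    by_cases hc : c = 0
    · exact ⟨0, fun h => absurd hc h⟩
    · obtain ⟨D, m, st, hm, hsub, rfl⟩ :=
        PlaneGerm.exists_isTransform (chart_props (hΦ i)).1 (chart_props (hΦ i)).2.1 hc
      exact ⟨st, fun _ => ⟨m, st, hm, hsub, rfl⟩⟩
  choose nxt hnxt using hex
  obtain ⟨g, hg0, hgs⟩ : ∃ g : ℕ → MvPowerSeries (Fin 2) k, g 0 = b ∧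
      ∀ i, g (i + 1) = nxt i (g i) :=
    ⟨fun i => Nat.rec (motive := fun _ => MvPowerSeries (Fin 2) k) b (fun i c => nxt i c) i, rfl,
      fun _ => rfl⟩
  have hne : ∀ i, g i ≠ 0 := fun i => by
    induction i with
    | zero => rwa [hg0]
    | succ i ih =>
      refine fun h0 => PlaneGerm.isTransform_ne_zero (chart_props (hΦ i)).2.2 (hnxt i (g i) ih) ?_
      rw [← hgs, h0, mul_zero]
  refine ⟨g, hg0, fun i => ⟨hne i, ?_⟩⟩
  obtain ⟨m, st, hm, hsub, hD⟩ := hnxt i (g i) (hne i)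
  refine ⟨m, hm, ?_⟩
  rw [hsub, hgs, mul_left_cancel₀ (FormalCoordChange.X_ne_zero' (0 : Fin 2)) hD]

section Chain

variable {f : ℕ → MvPowerSeries (Fin 2) k} {Φ : ℕ → Fin 2 → MvPowerSeries (Fin 2) k}
  (hN : ∀ i, ¬ PlaneGerm.IsNC (f i))
  (hΦk : ∀ i, (∃ t : k, Φ i = PlaneGerm.dirChart t) ∨ Φ i = PlaneGerm.vertChart k)
  (hΦt : ∀ i, PlaneGerm.IsTransform (Φ i) (f i) (f (i + 1)))
  (hC1 : ∀ (t : k) (v : MvPowerSeries (Fin 2) k) (a c : ℕ), constantCoeff v ≠ 0 → t ≠ 0 →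
    ∃ v' : MvPowerSeries (Fin 2) k, constantCoeff v' ≠ 0 ∧
      subst (PlaneGerm.dirChart t) (v * X 0 ^ a * X 1 ^ c) = X 0 ^ (a + c) * v')
  (hC2 : ∀ (v : MvPowerSeries (Fin 2) k) (a c : ℕ), constantCoeff v ≠ 0 →
    ∃ v' : MvPowerSeries (Fin 2) k, constantCoeff v' ≠ 0 ∧
      subst (PlaneGerm.dirChart 0) (v * X 0 ^ a * X 1 ^ c) = X 0 ^ (a + c) * (v' * X 1 ^ c))
  (hC3 : ∀ (v : MvPowerSeries (Fin 2) k) (a c : ℕ), constantCoeff v ≠ 0 →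
    ∃ v' : MvPowerSeries (Fin 2) k, constantCoeff v' ≠ 0 ∧
      subst (PlaneGerm.vertChart k) (v * X 0 ^ a * X 1 ^ c) = X 0 ^ (a + c) * (v' * X 1 ^ a))
  (hC4 : ∀ (v L : MvPowerSeries (Fin 2) k) (a c n : ℕ), constantCoeff v ≠ 0 →
    constantCoeff L = 0 → coeff (Finsupp.single 1 1) L ≠ 0 →
    (v * X 0 ^ a * X 1 ^ c * L ^ n).order = ((a + c + n : ℕ) : ℕ∞))
  (hC5a : ∀ (v : MvPowerSeries (Fin 2) k) (a c : ℕ), constantCoeff v ≠ 0 →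
    PlaneGerm.IsNC (v * X 0 ^ a * X 1 ^ c))
  (hC5b : ∀ (v L : MvPowerSeries (Fin 2) k) (n : ℕ), constantCoeff v ≠ 0 →
    constantCoeff L = 0 → coeff (Finsupp.single 1 1) L ≠ 0 → PlaneGerm.IsNC (v * X 0 * L ^ n))
  (hC6 : ∀ (t : k) (L : MvPowerSeries (Fin 2) k), constantCoeff L = 0 →
    coeff (Finsupp.single 1 1) L ≠ 0 →
    ∃ L' : MvPowerSeries (Fin 2) k, subst (PlaneGerm.dirChart t) L = X 0 * L' ∧
      coeff (Finsupp.single 1 1) L' = coeff (Finsupp.single 1 1) L ∧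
      constantCoeff L' = coeff (Finsupp.single 0 1) L + t * coeff (Finsupp.single 1 1) L ∧
      (t = 0 → ∀ n : ℕ, coeff (Finsupp.single 0 n) L' = coeff (Finsupp.single 0 (n + 1)) L))
  (hC7 : ∀ (L : MvPowerSeries (Fin 2) k), constantCoeff L = 0 → coeff (Finsupp.single 1 1) L ≠ 0 →
    ∃ w : MvPowerSeries (Fin 2) k, constantCoeff w ≠ 0 ∧ subst (PlaneGerm.vertChart k) L = X 0 * w)

include hΦk hΦt hC1 hC2 hC3 hC4 in
/-- THE EXCEPTIONAL INVARIANT: along the chain, `f i = v · x^a · y^c · g i` with `v` a unit, `a, c ≤ 1`,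
and `a = 1` from the first blow-up on (`g` the strict-transform sequence of `f 0`). -/
theorem invariant {g : ℕ → MvPowerSeries (Fin 2) k} (hg0 : g 0 = f 0)
    (hg : ∀ i, ∃ m : ℕ, (g i).order = m ∧ subst (Φ i) (g i) = X 0 ^ m * g (i + 1)) (i : ℕ) :
    ∃ (v : MvPowerSeries (Fin 2) k) (a c : ℕ), constantCoeff v ≠ 0 ∧ a ≤ 1 ∧ c ≤ 1 ∧
      (1 ≤ i → a = 1) ∧ f i = v * X 0 ^ a * X 1 ^ c * g i := by
  induction i with
  | zero =>
    exact ⟨1, 0, 0, by rw [map_one]; exact one_ne_zero, zero_le_one, zero_le_one, fun h => by omega,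
      by rw [hg0]; ring⟩
  | succ i ih =>
    obtain ⟨v, a, c, hv, ha, hc, -, hfi⟩ := ih
    obtain ⟨m, hm, hsub⟩ := hg i
    obtain ⟨hs, -, -⟩ := chart_props (hΦk i)
    obtain ⟨v', c', hv', hc', hE⟩ : ∃ (v' : MvPowerSeries (Fin 2) k) (c' : ℕ),
        constantCoeff v' ≠ 0 ∧ c' ≤ 1 ∧
          subst (Φ i) (v * X 0 ^ a * X 1 ^ c) = X 0 ^ (a + c) * (v' * X 1 ^ c') := by
      rcases hΦk i with ⟨t, ht⟩ | hV
      · by_cases ht0 : t = 0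
        · obtain ⟨v', hv', h⟩ := hC2 v a c hv
          exact ⟨v', c, hv', hc, by rw [ht, ht0, h]⟩
        · obtain ⟨v', hv', h⟩ := hC1 t v a c hv ht0
          exact ⟨v', 0, hv', zero_le_one, by rw [ht, h, pow_zero, mul_one]⟩
      · obtain ⟨v', hv', h⟩ := hC3 v a c hv
        exact ⟨v', a, hv', ha, by rw [hV, h]⟩
    have hordE : (v * X 0 ^ a * X 1 ^ c).order = ((a + c : ℕ) : ℕ∞) := by
      have h := hC4 v (X 1) a c 0 hv (constantCoeff_X 1)
        (by rw [coeff_index_single_self_X]; exact one_ne_zero)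
      rwa [pow_zero, mul_one, add_zero] at h
    have hord : (f i).order = ((a + c + m : ℕ) : ℕ∞) := by
      rw [hfi, order_mul (v * X 0 ^ a * X 1 ^ c) (g i), hordE, hm]
      norm_cast
    have hQ : subst (Φ i) (f i) = X 0 ^ (a + c + m) * (v' * X 1 ^ c' * g (i + 1)) := by
      rw [hfi, subst_mul hs, hE, hsub]
      ring
    refine ⟨v', 1, c', hv', le_rfl, hc', fun _ => rfl, ?_⟩
    rw [eq_X_mul_of_isTransform (hΦt i) hord hQ]
    ring

include hN hC5a in
/-- ENDGAME, the degenerate case `y ∣ L`: then `w · x · y^c · L^n` is a unit times a monomial. -/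
theorem endgame_dvd {i : ℕ} {w L : MvPowerSeries (Fin 2) k} {c n : ℕ} (hw : constantCoeff w ≠ 0)
    (hL1 : coeff (Finsupp.single 1 1) L ≠ 0) (hL : ∀ n', coeff (Finsupp.single 0 n') L = 0)
    (hfi : f i = w * X 0 * X 1 ^ c * L ^ n) : False := by
  obtain ⟨W, rfl⟩ : (X 1 : MvPowerSeries (Fin 2) k) ∣ L := by
    refine X_dvd_iff.mpr fun e he => ?_
    have hee : e = Finsupp.single 0 (e 0) := by
      ext j
      fin_cases j
      · simp
      · simpa using he
    rw [hee]
    exact hL _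
  rw [FormalShear.coeff_single_one_X_mul] at hL1
  refine hN i ?_
  rw [hfi, show w * X 0 * X 1 ^ c * (X 1 * W) ^ n = w * W ^ n * X 0 ^ 1 * X 1 ^ (c + n) by ring]
  exact hC5a _ 1 (c + n) (by rw [map_mul, map_pow]; exact mul_ne_zero hw (pow_ne_zero _ hL1))

include hN hΦk hΦt hC1 hC2 hC3 hC4 hC5a hC5b hC6 hC7 in
/-- ENDGAME: no bad chain passes through a germ `w · x · y^c · L^n` (`w` a unit, `c ≤ 1`, `L(0) = 0`,
`∂L/∂y(0) ≠ 0`, `coeff x^{n₀} L ≠ 0` with `n₀` least) — induction on `n₀`. -/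
theorem endgame (n₀ : ℕ) : ∀ (i : ℕ) (w L : MvPowerSeries (Fin 2) k) (c n : ℕ),
    constantCoeff w ≠ 0 → c ≤ 1 → constantCoeff L = 0 → coeff (Finsupp.single 1 1) L ≠ 0 →
    coeff (Finsupp.single 0 n₀) L ≠ 0 → (∀ n' < n₀, coeff (Finsupp.single 0 n') L = 0) →
    f i = w * X 0 * X 1 ^ c * L ^ n → False := by
  induction n₀ with
  | zero =>
    intro i w L c n _ _ hL0 _ hn₀ _ _
    exact hn₀ (by rwa [Finsupp.single_zero, coeff_zero_eq_constantCoeff_apply])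
  | succ n₀ ih =>
    intro i w L c n hw hc hL0 hL1 hn₀ hlow hfi
    obtain rfl | rfl : c = 0 ∨ c = 1 := by omega
    · exact hN i (by rw [hfi, pow_zero, mul_one]; exact hC5b w L n hw hL0 hL1)
    rw [pow_one] at hfi
    have hord : (f i).order = ((1 + 1 + n : ℕ) : ℕ∞) := by
      have h := hC4 w L 1 1 n hw hL0 hL1
      rwa [pow_one, pow_one, ← hfi] at h
    obtain ⟨hs, -, -⟩ := chart_props (hΦk i)
    rcases hΦk i with ⟨t, ht⟩ | hV
    · obtain ⟨L', hL', hL'1, hL'0, hL't⟩ := hC6 t L hL0 hL1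
      have hL1' : coeff (Finsupp.single 1 1) L' ≠ 0 := by rwa [← hL'1] at hL1
      rw [ht] at hs
      by_cases ht0 : t = 0
      · subst ht0
        obtain ⟨v', hv', hE⟩ := hC2 w 1 1 hw
        rw [pow_one, pow_one] at hE
        have hQ : subst (Φ i) (f i) = X 0 ^ (1 + 1 + n) * (v' * X 1 * L' ^ n) := by
          rw [ht, hfi, subst_mul hs, subst_pow hs, hE, hL']
          ring
        have hf1 := eq_X_mul_of_isTransform (hΦt i) hord hQ
        rw [zero_mul, add_zero] at hL'0
        rcases Nat.eq_zero_or_pos n₀ with rfl | hpos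
        · refine hN (i + 1) ?_
          rw [hf1, show X 0 * (v' * X 1 * L' ^ n) = v' * L' ^ n * X 0 ^ 1 * X 1 ^ 1 by ring]
          refine hC5a _ 1 1 ?_
          rw [map_mul, map_pow, hL'0]
          exact mul_ne_zero hv' (pow_ne_zero _ hn₀)
        · refine ih (i + 1) v' L' 1 n hv' le_rfl ?_ hL1' ?_ ?_ (by rw [hf1]; ring)
          · exact hL'0.trans (hlow 1 (by omega))
          · exact (hL't rfl n₀).trans_ne hn₀
          · exact fun n' hn' => (hL't rfl n').trans (hlow (n' + 1) (by omega))
      · obtain ⟨v', hv', hE⟩ := hC1 t w 1 1 hw ht0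
        rw [pow_one, pow_one] at hE
        have hQ : subst (Φ i) (f i) = X 0 ^ (1 + 1 + n) * (v' * L' ^ n) := by
          rw [ht, hfi, subst_mul hs, subst_pow hs, hE, hL']
          ring
        have hf1 := eq_X_mul_of_isTransform (hΦt i) hord hQ
        refine hN (i + 1) ?_
        by_cases hc' : constantCoeff L' = 0
        · rw [hf1, show X 0 * (v' * L' ^ n) = v' * X 0 * L' ^ n by ring]
          exact hC5b v' L' n hv' hc' hL1'
        · rw [hf1, show X 0 * (v' * L' ^ n) = v' * L' ^ n * X 0 ^ 1 * X 1 ^ 0 by ring]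
          exact hC5a _ 1 0 (by rw [map_mul, map_pow]; exact mul_ne_zero hv' (pow_ne_zero _ hc'))
    · obtain ⟨v', hv', hE⟩ := hC3 w 1 1 hw
      rw [pow_one, pow_one] at hE
      obtain ⟨W, hW, hLW⟩ := hC7 L hL0 hL1
      rw [hV] at hs
      have hQ : subst (Φ i) (f i) = X 0 ^ (1 + 1 + n) * (v' * X 1 * W ^ n) := by
        rw [hV, hfi, subst_mul hs, subst_pow hs, hE, hLW]
        ring
      have hf1 := eq_X_mul_of_isTransform (hΦt i) hord hQ
      refine hN (i + 1) ?_
      rw [hf1, show X 0 * (v' * X 1 * W ^ n) = v' * W ^ n * X 0 ^ 1 * X 1 ^ 1 by ring]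
      exact hC5a _ 1 1 (by rw [map_mul, map_pow]; exact mul_ne_zero hv' (pow_ne_zero _ hW))

end Chain

end BadChainAssembly

open BadChainAssembly MvPowerSeries in
/-- THE CHAIN ASSEMBLY (glue over (A) strict transforms and order, (C) exceptional and smooth calculus,
(P) persistent order forces an `m`-th power): no infinite chain of bad steps `f 0 → f 1 → ⋯` — order
stabilisation, the `m = 0` exit, no vertical steps, the persistent-order power, the endgame. -/
theorem stub_badChainAssembly : ∀ (k : Type) [Field k],
    (∀ (Φ : Fin 2 → MvPowerSeries (Fin 2) k), ((∃ t : k, Φ = PlaneGerm.dirChart t) ∨ Φ = PlaneGerm.vertChart k) →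
      ∀ (g h : MvPowerSeries (Fin 2) k) (m : ℕ), g.order = m →
        MvPowerSeries.subst Φ g = MvPowerSeries.X 0 ^ m * h → h.order ≤ m) ∧
    (∀ (Φ : Fin 2 → MvPowerSeries (Fin 2) k), ((∃ t : k, Φ = PlaneGerm.dirChart t) ∨ Φ = PlaneGerm.vertChart k) →
      ∀ (g h : MvPowerSeries (Fin 2) k) (m : ℕ), g.order = m →
        MvPowerSeries.subst Φ g = MvPowerSeries.X 0 ^ m * h → h.order = m →
        MvPowerSeries.coeff (Finsupp.single 1 m) h ≠ 0) ∧
    (∀ (g h : MvPowerSeries (Fin 2) k) (m : ℕ), g.order = m →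
      MvPowerSeries.coeff (Finsupp.single 1 m) g ≠ 0 →
      MvPowerSeries.subst (PlaneGerm.vertChart k) g = MvPowerSeries.X 0 ^ m * h →
      MvPowerSeries.constantCoeff h ≠ 0) →
    (∀ (t : k) (v : MvPowerSeries (Fin 2) k) (a c : ℕ), MvPowerSeries.constantCoeff v ≠ 0 → t ≠ 0 →
      ∃ v' : MvPowerSeries (Fin 2) k, MvPowerSeries.constantCoeff v' ≠ 0 ∧
        MvPowerSeries.subst (PlaneGerm.dirChart t) (v * MvPowerSeries.X 0 ^ a * MvPowerSeries.X 1 ^ c) =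
          MvPowerSeries.X 0 ^ (a + c) * v') ∧
    (∀ (v : MvPowerSeries (Fin 2) k) (a c : ℕ), MvPowerSeries.constantCoeff v ≠ 0 →
      ∃ v' : MvPowerSeries (Fin 2) k, MvPowerSeries.constantCoeff v' ≠ 0 ∧
        MvPowerSeries.subst (PlaneGerm.dirChart 0) (v * MvPowerSeries.X 0 ^ a * MvPowerSeries.X 1 ^ c) =
          MvPowerSeries.X 0 ^ (a + c) * (v' * MvPowerSeries.X 1 ^ c)) ∧
    (∀ (v : MvPowerSeries (Fin 2) k) (a c : ℕ), MvPowerSeries.constantCoeff v ≠ 0 →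
      ∃ v' : MvPowerSeries (Fin 2) k, MvPowerSeries.constantCoeff v' ≠ 0 ∧
        MvPowerSeries.subst (PlaneGerm.vertChart k) (v * MvPowerSeries.X 0 ^ a * MvPowerSeries.X 1 ^ c) =
          MvPowerSeries.X 0 ^ (a + c) * (v' * MvPowerSeries.X 1 ^ a)) ∧
    (∀ (v L : MvPowerSeries (Fin 2) k) (a c n : ℕ), MvPowerSeries.constantCoeff v ≠ 0 →
      MvPowerSeries.constantCoeff L = 0 → MvPowerSeries.coeff (Finsupp.single 1 1) L ≠ 0 →
      (v * MvPowerSeries.X 0 ^ a * MvPowerSeries.X 1 ^ c * L ^ n).order = ((a + c + n : ℕ) : ℕ∞)) ∧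
    (∀ (v : MvPowerSeries (Fin 2) k) (a c : ℕ), MvPowerSeries.constantCoeff v ≠ 0 →
      PlaneGerm.IsNC (v * MvPowerSeries.X 0 ^ a * MvPowerSeries.X 1 ^ c)) ∧
    (∀ (v L : MvPowerSeries (Fin 2) k) (n : ℕ), MvPowerSeries.constantCoeff v ≠ 0 →
      MvPowerSeries.constantCoeff L = 0 → MvPowerSeries.coeff (Finsupp.single 1 1) L ≠ 0 →
      PlaneGerm.IsNC (v * MvPowerSeries.X 0 * L ^ n)) ∧
    (∀ (t : k) (L : MvPowerSeries (Fin 2) k), MvPowerSeries.constantCoeff L = 0 →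
      MvPowerSeries.coeff (Finsupp.single 1 1) L ≠ 0 →
      ∃ L' : MvPowerSeries (Fin 2) k, MvPowerSeries.subst (PlaneGerm.dirChart t) L = MvPowerSeries.X 0 * L' ∧
        MvPowerSeries.coeff (Finsupp.single 1 1) L' = MvPowerSeries.coeff (Finsupp.single 1 1) L ∧
        MvPowerSeries.constantCoeff L' =
          MvPowerSeries.coeff (Finsupp.single 0 1) L + t * MvPowerSeries.coeff (Finsupp.single 1 1) L ∧
        (t = 0 → ∀ n : ℕ, MvPowerSeries.coeff (Finsupp.single 0 n) L' = MvPowerSeries.coeff (Finsupp.single 0 (n + 1)) L)) ∧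
    (∀ (L : MvPowerSeries (Fin 2) k), MvPowerSeries.constantCoeff L = 0 →
      MvPowerSeries.coeff (Finsupp.single 1 1) L ≠ 0 →
      ∃ w : MvPowerSeries (Fin 2) k, MvPowerSeries.constantCoeff w ≠ 0 ∧
        MvPowerSeries.subst (PlaneGerm.vertChart k) L = MvPowerSeries.X 0 * w) →
    (∀ (m : ℕ), 1 ≤ m →
    ∀ (h : ℕ → MvPowerSeries (Fin 2) k) (T : ℕ → k),
      (∀ j, (h j).order = m) →
      (∀ j, MvPowerSeries.subst (PlaneGerm.dirChart (T j)) (h j) = MvPowerSeries.X 0 ^ m * h (j + 1)) →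
      ∃ (u L : MvPowerSeries (Fin 2) k), MvPowerSeries.constantCoeff u ≠ 0 ∧ MvPowerSeries.constantCoeff L = 0 ∧
        MvPowerSeries.coeff (Finsupp.single 1 1) L ≠ 0 ∧ h 0 = u * L ^ m) →
    (∀ f : ℕ → MvPowerSeries (Fin 2) k, ∃ i, ¬ PlaneGerm.IsBadStep (f i) (f (i + 1))) := by
  intro k _ hA hC hP f
  classical
  obtain ⟨hA1, hA2, hA3⟩ := hA
  obtain ⟨hC1, hC2, hC3, hC4, hC5a, hC5b, hC6, hC7⟩ := hC
  by_contra hcon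
  push Not at hcon
  have hbad : ∀ i, f i ≠ 0 ∧ ¬ PlaneGerm.IsNC (f i) ∧ PlaneGerm.IsSuccessor (f i) (f (i + 1)) :=
    fun i => (PlaneGerm.isBadStep_iff _ _).mp (hcon i)
  have hN : ∀ i, ¬ PlaneGerm.IsNC (f i) := fun i => (hbad i).2.1
  -- (1) the charts
  have hΦex : ∀ i, ∃ Φ : Fin 2 → MvPowerSeries (Fin 2) k,
      ((∃ t : k, Φ = PlaneGerm.dirChart t) ∨ Φ = PlaneGerm.vertChart k) ∧
        PlaneGerm.IsTransform Φ (f i) (f (i + 1)) := by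
    intro i
    rcases (hbad i).2.2 with ⟨t, ht⟩ | hv
    · exact ⟨_, Or.inl ⟨t, rfl⟩, ht⟩
    · exact ⟨_, Or.inr rfl, hv⟩
  choose Φ hΦk hΦt using hΦex
  -- (2) the strict-transform sequence and its orders
  obtain ⟨g, hg0, hg⟩ := exists_strictSeq hΦk (hbad 0).1
  have hgm : ∀ i, ∃ m : ℕ, (g i).order = m ∧ subst (Φ i) (g i) = X 0 ^ m * g (i + 1) :=
    fun i => (hg i).2
  choose o ho hstep using hgm
  -- (4) order stabilisation
  have hanti : ∀ i, o (i + 1) ≤ o i := fun i => by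
    simpa [ho (i + 1)] using hA1 (Φ i) (hΦk i) (g i) (g (i + 1)) (o i) (ho i) (hstep i)
  obtain ⟨i₀, hi₀⟩ : ∃ i₀, ∀ i, i₀ ≤ i → o i = o i₀ := by
    obtain ⟨i₀, hi₀⟩ := Nat.sInf_mem (Set.range_nonempty o)
    exact ⟨i₀, fun i hi => le_antisymm (antitone_nat_of_succ_le hanti hi) (hi₀.trans_le (Nat.sInf_le ⟨i, rfl⟩))⟩
  have hinv := invariant hΦk hΦt hC1 hC2 hC3 hC4 hg0 fun i => ⟨o i, ho i, hstep i⟩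
  rcases Nat.eq_zero_or_pos (o i₀) with hm0 | hm1
  · -- (5) `m = 0`: `f i₀` is a unit times a monomial
    obtain ⟨v, a, c, hv, -, -, -, hfi⟩ := hinv i₀
    have hcc : constantCoeff (g i₀) ≠ 0 := fun h0 =>
      order_ne_zero_iff_constCoeff_eq_zero.mpr h0 (by rw [ho, hm0, Nat.cast_zero])
    refine hN i₀ ?_
    rw [hfi, show v * X 0 ^ a * X 1 ^ c * g i₀ = v * g i₀ * X 0 ^ a * X 1 ^ c by ring]
    exact hC5a _ a c (by rw [map_mul]; exact mul_ne_zero hv hcc)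
  · -- (6a) `m ≥ 1`: `y^m` persists, so no vertical step after `i₀ + 1`
    have hy : ∀ i, i₀ ≤ i → coeff (Finsupp.single 1 (o i₀)) (g (i + 1)) ≠ 0 := fun i hi =>
      hA2 (Φ i) (hΦk i) (g i) (g (i + 1)) (o i₀) (by rw [ho, hi₀ i hi]) (by rw [hstep, hi₀ i hi])
        (by rw [ho, hi₀ (i + 1) (by omega)])
    have hT : ∀ j, ∃ t : k, Φ (i₀ + 1 + j) = PlaneGerm.dirChart t := by
      intro j
      refine (hΦk _).resolve_right fun hV => ?_
      have hyj := hy (i₀ + j) (by omega)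
      rw [Nat.add_right_comm] at hyj
      refine hA3 (g (i₀ + 1 + j)) (g (i₀ + 1 + j + 1)) (o i₀) (by rw [ho, hi₀ _ (by omega)]) hyj
        (by rw [← hV, hstep, hi₀ _ (by omega)]) ?_
      exact order_ne_zero_iff_constCoeff_eq_zero.mp
        (by rw [ho, hi₀ _ (by omega)]; exact_mod_cast hm1.ne')
    choose T hT using hT
    -- (6b) the persistent-order power
    obtain ⟨u, L, hu, hL0, hL1, hh0⟩ := hP (o i₀) hm1 (fun j => g (i₀ + 1 + j)) T
      (fun j => by rw [ho, hi₀ _ (by omega)]) (fun j => by rw [← hT j, hstep, hi₀ _ (by omega)]; rfl)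
    obtain ⟨v, a, c, hv, -, hc, ha, hfi⟩ := hinv (i₀ + 1)
    obtain rfl := ha (by omega)
    have hfi' : f (i₀ + 1) = v * u * X 0 * X 1 ^ c * L ^ (o i₀) := by
      rw [hfi, pow_one, show g (i₀ + 1) = u * L ^ (o i₀) from hh0]
      ring
    have hvu : constantCoeff (v * u) ≠ 0 := by rw [map_mul]; exact mul_ne_zero hv hu
    -- (6c, 6d) the endgame
    by_cases hall : ∀ n', coeff (Finsupp.single 0 n') L = 0
    · exact endgame_dvd hN hC5a hvu hL1 hall hfi'
    · push Not at hall
      exact endgame hN hΦk hΦt hC1 hC2 hC3 hC4 hC5a hC5b hC6 hC7 (Nat.find hall) (i₀ + 1) (v * u) L c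
        (o i₀) hvu hc hL0 hL1 (Nat.find_spec hall) (fun n' hn' => not_not.mp (Nat.find_min hall hn'))
        hfi'

end Summit.ResolutionOfSingularities.ResolutionOfSingularities.Theorems
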